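/- Fleet lead `ym-wcr-19456-p1` (seat g2), route `WeakCouplingRates`, crux `ColdBoxTwoPointFloorW` (stmt-QuantumFields-19608). -/
-- tree-module: Summits.QuantumFields.YangMills.Theorems.WeakCouplingRatesColdBoxTwoPointFloorWStubBoxGaussianDomination
import Summits.QuantumFields.YangMills.Theorems.WeakCouplingRatesColdBoxDominationCore
import Summits.QuantumFields.YangMills.Theorems.WeakCouplingRatesColdBoxExponents
import Summits.QuantumFields.YangMills.Theorems.WeakCouplingRatesColdBoxStubOfAbs

/-!
# Crux `ColdBoxTwoPointFloorW` (stmt-QuantumFields-19608), line `birth`, skeleton v5 (sha16 `541595052a14e13c`): the registered stub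
# `stub_boxGaussianDomination` — PROVED

Route `WeakCouplingRates` (rev 2), fleet lead `ym-wcr-19456-p1`.  This file proves the registered stub BY NAME AND SIGNATURE:

`stub_boxGaussianDomination : ∃ θ₀ : ℝ, 0 < θ₀ ∧ ∀ A θ : ℝ, 0 < A → A < θ → θ ≤ θ₀ → ∃ β₀ : ℝ, ∀ β : ℝ, β₀ ≤ β →
  |β ^ 2 * boxPlaqCov (fundamentalRep (Fin 2)) β ⌈β ^ θ⌉₊ ⌈β ^ A⌉₊ - 3 / 4 * boxCircSqCov ⌈β ^ θ⌉₊ ⌈β ^ A⌉₊| ≤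
    1 / 2 * boxMaxwellPlaqCov ⌈β ^ θ⌉₊ ⌈β ^ A⌉₊ ^ 2` — with `θ₀ = 1/100`.

## The argument (the one-scale expansion of the cold-wall `SU(2)` box; every input is a tree theorem)

1. **`boxDirichletDominationAbs`** (the ABSOLUTE Dirichlet comparison, the lead's v7 `stub_boxDirichletDominationAbs`): for `0 < θ ≤ 1/100`,
   `κ = 9θ`, eventually in `β`, for all `T ≤ H = ⌈β^θ⌉`: `|β²·boxPlaqCov β H T − ¾·boxDirCircSqCov H T| ≤ β^{−κ}`.  With `ε = 3θ`:
   large fields are rare in the cold box (`abs_boxPlaqCov_sub_cond_le`, p450121: conditioning on `coldGoodSet` costs `96e^{−β^ε}`); in the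
   temporal-forest gauge and the gnomonic chart the conditioned box state IS a bounded tilt of the conditioned Dirichlet Gaussian
   `boxDirichlet^{⊗3}` (`integral_cond_boxState_eq_integral_tilted`, `…ColdBoxRepresentation`); the tilt is `O(β^{19θ−1/2})` on the good event
   (`…ColdBoxTiltBound`, bricks R1/R3), the Gaussian mass of the bad event is `e^{−β^{6θ}/8}`-small (`…ColdBoxGaussTail`, R5), the costs are
   their quadratic surrogates up to `362βm³` (R3) whose covariance is `¾·boxDirCircSqCov` (`…ColdBoxColourCov`); the bookkeeping
   `abs_cov_tilted_cond_sub_cov_le` (R6) and the deterministic core `abs_boxPlaqCov_sub_dirCircSqCov_le_core` give an explicit bound, which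
   `core_rhs_le_inv_pow` (R7) shows to be `≤ β^{−9θ}` once `40θ < ½`.
2. **`stub_boxGaussianDomination`** = `stub_boxGaussianDomination_of_abs boxDirichletDominationAbs` (`…ColdBoxStubOfAbs`, p468818: Dirichlet/free
   Wick + the kernel comparisons of seat ym-wcr-19608-p2).

No sorry, no new definition, no named-fact hypothesis; standard axioms.  NOT a claim about the mass gap: a finite-volume, weak-coupling
statement about one Wilson box.
-/

set_option autoImplicit false

noncomputable section

open MeasureTheory ProbabilityTheory Finset Real Filter Topology
open Literature.Probability.LatticeModels (Site)
open Literature.MathematicalPhysics.QuantumLattice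
open Literature.MathematicalPhysics.QuantumFieldTheory
open Literature.MathematicalPhysics.QuantumFieldTheory.LatticeMaxwell
open Literature.MathematicalPhysics.QuantumFieldTheory.AxialGauge

namespace Summit.QuantumFields.YangMills.Theorems.WeakCouplingRates

/-! ## Numerical constants -/

/-- `√2 ≤ 85/60`. -/
theorem sqrt_two_le : Real.sqrt 2 ≤ 85 / 60 :=
  (Real.sqrt_le_sqrt (by norm_num : (2 : ℝ) ≤ (85 / 60) ^ 2)).trans_eq (Real.sqrt_sq (by norm_num))

/-- `60·√3 ≤ 74·√2`. -/
theorem sixty_sqrt_three_le : 60 * Real.sqrt 3 ≤ 74 * Real.sqrt 2 := by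
  have h3 : Real.sqrt 3 ^ 2 = 3 := Real.sq_sqrt (by norm_num)
  have h2 : Real.sqrt 2 ^ 2 = 2 := Real.sq_sqrt (by norm_num)
  have hsq : (60 * Real.sqrt 3) ^ 2 ≤ (74 * Real.sqrt 2) ^ 2 := by rw [mul_pow, mul_pow, h3, h2]; norm_num
  exact (pow_le_pow_iff_left₀ (by positivity) (by positivity) two_ne_zero).1 hsq

/-! ## The four smallness conditions hold eventually (`θ ≤ 1/100`) -/

/-- Eventually in `β`: `5·10¹⁶ · u · y³⁵ ≤ 1`, `480β²y⁹e^{−y³} ≤ 1`, `3·10⁷y²⁵e^{−y⁶/8} ≤ 1`, `2·10⁵y¹⁷e^{−y⁶/16} ≤ 1`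
(`y = β^θ`, `u = β^{5θ−1/2}`), provided `0 < θ` and `40θ < 1/2`. -/
theorem eventually_smallness {θ : ℝ} (hθ : 0 < θ) (hθ₁ : θ ≤ 1 / 100) :
    ∀ᶠ β : ℝ in atTop, 5e16 * β ^ (5 * θ - 1 / 2) * (β ^ θ) ^ 35 ≤ 1 ∧
      480 * β ^ 2 * (β ^ θ) ^ 9 * Real.exp (-((β ^ θ) ^ 3)) ≤ 1 ∧
      3e7 * (β ^ θ) ^ 25 * Real.exp (-((β ^ θ) ^ 6 / 8)) ≤ 1 ∧
      2e5 * (β ^ θ) ^ 17 * Real.exp (-((β ^ θ) ^ 6 / 16)) ≤ 1 := by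
  have hs : 0 < 1 / 2 - 40 * θ := by linarith
  have e7 := eventually_le_one_of_tendsto_zero (tendsto_const_mul_rpow_of_neg 5e16 hs)
  have e6 := eventually_le_one_of_tendsto_zero (tendsto_const_mul_rpow_mul_exp_neg 480 (2 + 9 * θ) (a := 3 * θ) (b := 1)
    (by linarith) one_pos)
  have e8 := eventually_le_one_of_tendsto_zero (tendsto_const_mul_rpow_mul_exp_neg 3e7 (25 * θ) (a := 6 * θ) (b := 1 / 8)
    (by linarith) (by norm_num))
  have e10 := eventually_le_one_of_tendsto_zero (tendsto_const_mul_rpow_mul_exp_neg 2e5 (17 * θ) (a := 6 * θ) (b := 1 / 16)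
    (by linarith) (by norm_num))
  filter_upwards [e7, e6, e8, e10, eventually_gt_atTop 0] with β h7 h6 h8 h10 hβ
  have hpow : ∀ (n : ℕ), (β ^ θ) ^ n = β ^ ((n : ℝ) * θ) := fun n => by
    rw [← Real.rpow_natCast, ← Real.rpow_mul hβ.le, mul_comm]
  refine ⟨?_, ?_, ?_, ?_⟩
  · have e : β ^ (5 * θ - 1 / 2) * (β ^ θ) ^ 35 = β ^ (-(1 / 2 - 40 * θ)) := by
      rw [hpow, ← Real.rpow_add hβ]; push_cast; ring_nf
    rw [mul_assoc, e]; exact h7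
  · have e : β ^ 2 * (β ^ θ) ^ 9 = β ^ (2 + 9 * θ) := by
      rw [hpow, ← Real.rpow_two, ← Real.rpow_add hβ]; push_cast; ring_nf
    have e3 : (β ^ θ) ^ 3 = 1 * β ^ (3 * θ) := by rw [hpow]; push_cast; ring
    rw [mul_assoc 480, e, e3]; exact h6
  · have e : (β ^ θ) ^ 25 = β ^ (25 * θ) := by rw [hpow]; push_cast; ring_nf
    have e6 : (β ^ θ) ^ 6 / 8 = 1 / 8 * β ^ (6 * θ) := by rw [hpow]; push_cast; ring
    rw [e, e6]; exact h8
  · have e : (β ^ θ) ^ 17 = β ^ (17 * θ) := by rw [hpow]; push_cast; ring_nf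
    have e6 : (β ^ θ) ^ 6 / 16 = 1 / 16 * β ^ (6 * θ) := by rw [hpow]; push_cast; ring
    rw [e, e6]; exact h10

/-! ## The absolute Dirichlet comparison -/

set_option maxHeartbeats 400000 in
/-- **`boxDirichletDominationAbs` (the lead's v7 `stub_boxDirichletDominationAbs`).**  There is `θ₀ > 0` (`= 1/100`) such that for every
`0 < θ ≤ θ₀` there is `κ > 8θ` (`= 9θ`) with: eventually in `β`, for every separation `T ≤ H = ⌈β^θ⌉`,
`|β²·boxPlaqCov β H T − ¾·boxDirCircSqCov H T| ≤ β^{−κ}` — the `SU(2)` cold-wall box covariance equals, to ABSOLUTE precision `β^{−κ}`,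
`¾` of the connected two-point function of the squared circulations of its own temporal-gauge Dirichlet Gaussian. -/
theorem boxDirichletDominationAbs : ∃ θ₀ : ℝ, 0 < θ₀ ∧ ∀ θ : ℝ, 0 < θ → θ ≤ θ₀ → ∃ κ : ℝ, 8 * θ < κ ∧ ∃ β₀ : ℝ, ∀ β : ℝ, β₀ ≤ β →
    ∀ T : ℕ, T ≤ ⌈β ^ θ⌉₊ →
      |β ^ 2 * boxPlaqCov (fundamentalRep (Fin 2)) β ⌈β ^ θ⌉₊ T - 3 / 4 * boxDirCircSqCov ⌈β ^ θ⌉₊ T| ≤ β ^ (-κ) := by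
  refine ⟨1 / 100, by norm_num, fun θ hθ hθ₁ => ⟨9 * θ, by linarith, ?_⟩⟩
  have hε : 2 * θ < 3 * θ := by linarith
  obtain ⟨β₁, hcond⟩ := abs_boxPlaqCov_sub_cond_le (ε := 3 * θ) hθ hε
  obtain ⟨β₂, hrare⟩ := boxState_largeField_rarity (ε := 3 * θ) hθ hε
  obtain ⟨β₃, hsmall⟩ := Filter.eventually_atTop.1 (eventually_smallness hθ hθ₁)
  refine ⟨max (max β₁ β₂) (max β₃ 1), fun β hβ T hT => ?_⟩
  have hb₁ : β₁ ≤ β := le_trans (le_trans (le_max_left _ _) (le_max_left _ _)) hβ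
  have hb₂ : β₂ ≤ β := le_trans (le_trans (le_max_right _ _) (le_max_left _ _)) hβ
  have hb₃ : β₃ ≤ β := le_trans (le_trans (le_max_left _ _) (le_max_right _ _)) hβ
  have hβ1 : 1 ≤ β := le_trans (le_trans (le_max_right _ _) (le_max_right _ _)) hβ
  have hβ0 : 0 < β := by linarith
  obtain ⟨h7, h6, h8, h10⟩ := hsmall β hb₃
  -- the variables `y = β^θ`, `u = β^{5θ−1/2}`, and the box side
  set H : ℕ := ⌈β ^ θ⌉₊ with hHdef
  have hy : 1 ≤ β ^ θ := Real.one_le_rpow hβ1 hθ.le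
  have hy0 : 0 < β ^ θ := by linarith
  have hu : 0 < β ^ (5 * θ - 1 / 2) := Real.rpow_pos_of_pos hβ0 _
  have huy : (β ^ (5 * θ - 1 / 2)) ^ 2 * β = (β ^ θ) ^ 10 := u_sq_mul_eq hβ0
  obtain ⟨hH1r, hH2⟩ := one_le_ceil_rpow_and_le (A := θ) hβ1 hθ.le
  have hH : 1 ≤ H := by exact_mod_cast hH1r
  have hHr : (1 : ℝ) ≤ (H : ℝ) := by exact_mod_cast hH
  have huy35 : β ^ (5 * θ - 1 / 2) * (β ^ θ) ^ 35 ≤ 2e-17 := by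
    have e : 5e16 * β ^ (5 * θ - 1 / 2) * (β ^ θ) ^ 35 = 5e16 * (β ^ (5 * θ - 1 / 2) * (β ^ θ) ^ 35) := by ring
    rw [e] at h7; linarith
  have hu_small : β ^ (5 * θ - 1 / 2) ≤ 2e-17 :=
    (le_mul_of_one_le_right hu.le (one_le_pow₀ hy)).trans huy35
  have huy4 : β ^ (5 * θ - 1 / 2) * (β ^ θ) ^ 4 ≤ 2e-17 :=
    (mul_le_mul_of_nonneg_left (pow_le_pow_right₀ hy (by norm_num : 4 ≤ 35)) hu.le).trans huy35
  -- the link-count polynomial `12H²+2H+1 ≤ 60 y²`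
  have hA : 12 * (H : ℝ) ^ 2 + 2 * H + 1 ≤ 60 * (β ^ θ) ^ 2 := by
    have h1 : (H : ℝ) ^ 2 ≤ (2 * β ^ θ) ^ 2 := pow_le_pow_left₀ (by positivity) hH2 2
    have h2 : (H : ℝ) ≤ (H : ℝ) ^ 2 := by nlinarith
    have h3 : (1 : ℝ) ≤ (β ^ θ) ^ 2 := one_le_pow₀ hy
    nlinarith
  have hA0 : 0 ≤ 12 * (H : ℝ) ^ 2 + 2 * H + 1 := by positivity
  -- (hm) the link bound
  have hm : Real.sqrt 2 * ((12 * (H : ℝ) ^ 2 + 2 * H + 1) * Real.sqrt (β ^ (2 * (3 * θ) - 1))) ≤ 85 * β ^ (5 * θ - 1 / 2) := by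
    rw [sqrt_rpow_eq hβ0]
    have h1 : (12 * (H : ℝ) ^ 2 + 2 * H + 1) * (β ^ (5 * θ - 1 / 2) / (β ^ θ) ^ 2) ≤ 60 * β ^ (5 * θ - 1 / 2) := by
      rw [mul_div_assoc', div_le_iff₀ (by positivity)]
      calc (12 * (H : ℝ) ^ 2 + 2 * H + 1) * β ^ (5 * θ - 1 / 2) ≤ 60 * (β ^ θ) ^ 2 * β ^ (5 * θ - 1 / 2) :=
            mul_le_mul_of_nonneg_right hA hu.le
        _ = 60 * β ^ (5 * θ - 1 / 2) * (β ^ θ) ^ 2 := by ring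
    calc Real.sqrt 2 * ((12 * (H : ℝ) ^ 2 + 2 * H + 1) * (β ^ (5 * θ - 1 / 2) / (β ^ θ) ^ 2))
        ≤ 85 / 60 * (60 * β ^ (5 * θ - 1 / 2)) := mul_le_mul sqrt_two_le h1 (by positivity) (by norm_num)
      _ = 85 * β ^ (5 * θ - 1 / 2) := by ring
  have hm4 : 85 * β ^ (5 * θ - 1 / 2) ≤ 1 / 4 := by linarith
  -- (hmE) the Gaussian link bound
  have hR0 : 0 ≤ (β ^ θ) ^ 3 / 2 := by positivity
  have hmE37 : Real.sqrt 3 * (12 * (H : ℝ) ^ 2 + 2 * H + 1) * ((β ^ θ) ^ 3 / 2) / Real.sqrt (2 * β) ≤ 37 * β ^ (5 * θ - 1 / 2) := by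
    rw [sqrt_two_mul_eq (θ := θ) hβ0]
    have hs2 : 0 < Real.sqrt 2 := Real.sqrt_pos.2 (by norm_num)
    have hden : 0 < Real.sqrt 2 * (β ^ θ) ^ 5 / β ^ (5 * θ - 1 / 2) := by positivity
    rw [div_le_iff₀ hden]
    have h60 := sixty_sqrt_three_le
    have hs3 : 0 ≤ Real.sqrt 3 := Real.sqrt_nonneg _
    -- `√3·A·y³/2 ≤ √3·60y²·y³/2 = 30·(60√3/60)… ≤ 37·√2·y⁵`
    have h1 : Real.sqrt 3 * (12 * (H : ℝ) ^ 2 + 2 * H + 1) * ((β ^ θ) ^ 3 / 2) ≤ Real.sqrt 3 * (60 * (β ^ θ) ^ 2) * ((β ^ θ) ^ 3 / 2) :=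
      mul_le_mul_of_nonneg_right (mul_le_mul_of_nonneg_left hA hs3) hR0
    have h2 : Real.sqrt 3 * (60 * (β ^ θ) ^ 2) * ((β ^ θ) ^ 3 / 2) = 30 * (60 * Real.sqrt 3) / 60 * (β ^ θ) ^ 5 := by ring
    have h3 : 30 * (60 * Real.sqrt 3) / 60 * (β ^ θ) ^ 5 ≤ 30 * (74 * Real.sqrt 2) / 60 * (β ^ θ) ^ 5 := by gcongr
    have h4 : 30 * (74 * Real.sqrt 2) / 60 * (β ^ θ) ^ 5 = 37 * β ^ (5 * θ - 1 / 2) * (Real.sqrt 2 * (β ^ θ) ^ 5 / β ^ (5 * θ - 1 / 2)) := by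
      field_simp
      ring
    linarith
  have hmE : Real.sqrt 3 * (12 * (H : ℝ) ^ 2 + 2 * H + 1) * ((β ^ θ) ^ 3 / 2) / Real.sqrt (2 * β) ≤ 1 / 4 := by linarith
  -- (hwin) the Gaussian window
  have hwin : 3 * ((β ^ θ) ^ 3 / 2) ^ 2 / (2 * β) +
      362 * (Real.sqrt 3 * (12 * (H : ℝ) ^ 2 + 2 * H + 1) * ((β ^ θ) ^ 3 / 2) / Real.sqrt (2 * β)) ^ 3 < β ^ (2 * (3 * θ) - 1) := by
    rw [rpow_two_eps_sub_one_eq hβ0]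
    have hmE0 : 0 ≤ Real.sqrt 3 * (12 * (H : ℝ) ^ 2 + 2 * H + 1) * ((β ^ θ) ^ 3 / 2) / Real.sqrt (2 * β) := by positivity
    have hcube : (Real.sqrt 3 * (12 * (H : ℝ) ^ 2 + 2 * H + 1) * ((β ^ θ) ^ 3 / 2) / Real.sqrt (2 * β)) ^ 3 ≤ (37 * β ^ (5 * θ - 1 / 2)) ^ 3 :=
      pow_le_pow_left₀ hmE0 hmE37 3
    have hfirst : 3 * ((β ^ θ) ^ 3 / 2) ^ 2 / (2 * β) = 3 / 8 * ((β ^ (5 * θ - 1 / 2)) ^ 2 / (β ^ θ) ^ 4) := by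
      have hy4 : (β ^ θ) ^ 4 ≠ 0 := by positivity
      have hβne : β ≠ 0 := hβ0.ne'
      -- clear denominators by hand
      have e1 : 3 * ((β ^ θ) ^ 3 / 2) ^ 2 / (2 * β) = 3 * (β ^ θ) ^ 6 / (8 * β) := by ring
      rw [e1, div_eq_iff (by positivity : (8 : ℝ) * β ≠ 0)]
      have e2 : 3 / 8 * ((β ^ (5 * θ - 1 / 2)) ^ 2 / (β ^ θ) ^ 4) * (8 * β) =
          3 * ((β ^ (5 * θ - 1 / 2)) ^ 2 * β) / (β ^ θ) ^ 4 := by field_simp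
      rw [e2, huy]
      field_simp
    rw [hfirst]
    have hy4 : 0 < (β ^ θ) ^ 4 := by positivity
    -- `362·(37u)³ < (5/8)u²/y⁴` from `u y⁴ ≤ 2e-17`
    have hkey : 362 * (37 * β ^ (5 * θ - 1 / 2)) ^ 3 < 5 / 8 * ((β ^ (5 * θ - 1 / 2)) ^ 2 / (β ^ θ) ^ 4) := by
      rw [mul_div_assoc', lt_div_iff₀ hy4]
      have hu2 : 0 < (β ^ (5 * θ - 1 / 2)) ^ 2 := by positivity
      have h1 : (β ^ (5 * θ - 1 / 2)) ^ 2 * (β ^ (5 * θ - 1 / 2) * (β ^ θ) ^ 4) ≤ (β ^ (5 * θ - 1 / 2)) ^ 2 * 2e-17 :=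
        mul_le_mul_of_nonneg_left huy4 hu2.le
      calc 362 * (37 * β ^ (5 * θ - 1 / 2)) ^ 3 * (β ^ θ) ^ 4
          = 18336386 * ((β ^ (5 * θ - 1 / 2)) ^ 2 * (β ^ (5 * θ - 1 / 2) * (β ^ θ) ^ 4)) := by ring
        _ ≤ 18336386 * ((β ^ (5 * θ - 1 / 2)) ^ 2 * 2e-17) := by gcongr
        _ < 5 / 8 * (β ^ (5 * θ - 1 / 2)) ^ 2 := by nlinarith
    linarith
  -- (hp), (hp1) the Gaussian bad event
  have h2H : (2 * (H : ℝ) + 1) ^ 4 ≤ 1296 * (β ^ θ) ^ 4 := by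
    have h1 : 2 * (H : ℝ) + 1 ≤ 6 * β ^ θ := by linarith
    calc (2 * (H : ℝ) + 1) ^ 4 ≤ (6 * β ^ θ) ^ 4 := pow_le_pow_left₀ (by positivity) h1 4
      _ = 1296 * (β ^ θ) ^ 4 := by ring
  have hp : 720 * (2 * (H : ℝ) + 1) ^ 4 * Real.exp (-((β ^ θ) ^ 3 / 2) ^ 2 / 2) ≤
      933120 * (β ^ θ) ^ 4 * Real.exp (-(((β ^ θ) ^ 3 / 2) ^ 2 / 2)) := by
    rw [neg_div]
    calc 720 * (2 * (H : ℝ) + 1) ^ 4 * Real.exp (-(((β ^ θ) ^ 3 / 2) ^ 2 / 2))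
        ≤ 720 * (1296 * (β ^ θ) ^ 4) * Real.exp (-(((β ^ θ) ^ 3 / 2) ^ 2 / 2)) := by gcongr
      _ = _ := by ring
  have hexp8 : Real.exp (-(((β ^ θ) ^ 3 / 2) ^ 2 / 2)) = Real.exp (-((β ^ θ) ^ 6 / 8)) := by congr 1; ring
  have hp1 : 933120 * (β ^ θ) ^ 4 * Real.exp (-(((β ^ θ) ^ 3 / 2) ^ 2 / 2)) < 1 := by
    rw [hexp8]
    have hy4_25 : (β ^ θ) ^ 4 ≤ (β ^ θ) ^ 25 := pow_le_pow_right₀ hy (by norm_num)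
    calc 933120 * (β ^ θ) ^ 4 * Real.exp (-((β ^ θ) ^ 6 / 8)) ≤ 933120 * (β ^ θ) ^ 25 * Real.exp (-((β ^ θ) ^ 6 / 8)) := by gcongr
      _ = 933120 / 3e7 * (3e7 * (β ^ θ) ^ 25 * Real.exp (-((β ^ θ) ^ 6 / 8))) := by ring
      _ ≤ 933120 / 3e7 * 1 := by gcongr
      _ < 1 := by norm_num
  -- (hG0) the box state charges the good event
  set μ := boxState (fundamentalRep (Fin 2)) β H with hμ
  have hG0 : μ (coldGoodSet β (3 * θ) H) ≠ 0 := by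
    have hGm : MeasurableSet (coldGoodSet β (3 * θ) H) := measurableSet_coldGoodSet β (3 * θ) H
    have hbad : μ.real (coldGoodSet β (3 * θ) H)ᶜ ≤ Real.exp (-(β ^ (3 * θ))) := by
      have := hrare β hb₂
      rw [coldGoodSet, compl_compl]; exact this
    have hbad1 : μ.real (coldGoodSet β (3 * θ) H)ᶜ < 1 := lt_of_le_of_lt hbad (by
      rw [Real.exp_lt_one_iff]
      have : 0 < β ^ (3 * θ) := Real.rpow_pos_of_pos hβ0 _
      linarith)
    intro h0
    have h1 : μ.real (coldGoodSet β (3 * θ) H) = 0 := by rw [measureReal_def, h0, ENNReal.toReal_zero]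
    have h2 : μ.real (coldGoodSet β (3 * θ) H) + μ.real (coldGoodSet β (3 * θ) H)ᶜ = 1 := by
      rw [measureReal_add_measureReal_compl hGm, probReal_univ]
    linarith
  -- (hcond) the large-field conditioning
  have hc := hcond β hb₁ T
  rw [rpow_three_mul_eq hβ0] at hc
  -- the deterministic core and the bookkeeping
  have hcore := abs_boxPlaqCov_sub_dirCircSqCov_le_core (ε := 3 * θ) (m := 85 * β ^ (5 * θ - 1 / 2)) (R := (β ^ θ) ^ 3 / 2)
    (p := 933120 * (β ^ θ) ^ 4 * Real.exp (-(((β ^ θ) ^ 3 / 2) ^ 2 / 2))) (c₀ := 96 * Real.exp (-((β ^ θ) ^ 3)))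
    hβ1 hH hT hm hm4 hR0 hmE hwin hp hp1 hG0 hc
  rw [rpow_two_mul_three_eq hβ0] at hcore
  have hP : (#(plaquettesTouching (boxEdges 4 (2 * H + 1))) : ℝ) ≤ 155520 * (β ^ θ) ^ 4 := by
    have h := card_plaquettesTouching_boxEdges_le (2 * H + 1)
    have h' : ((#(plaquettesTouching (boxEdges 4 (2 * H + 1))) : ℕ) : ℝ) ≤ ((120 * (2 * H + 1) ^ 4 : ℕ) : ℝ) := by exact_mod_cast h
    push_cast at h'
    linarith [h2H]
  have hN : (Fintype.card (ColdFreeIdx H) : ℝ) ≤ 5184 * (β ^ θ) ^ 4 := by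
    have h1 : Fintype.card (ColdFreeIdx H) ≤ Fintype.card ↥(boxEdges 4 (2 * H + 1)) := Fintype.card_subtype_le _
    rw [Fintype.card_coe] at h1
    have h2 := card_boxEdges_four_le (2 * H + 1)
    have h' : ((Fintype.card (ColdFreeIdx H) : ℕ) : ℝ) ≤ ((4 * (2 * H + 1) ^ 4 : ℕ) : ℝ) := by exact_mod_cast h1.trans h2
    push_cast at h'
    linarith [h2H]
  have hrhs := core_rhs_le_inv_pow (P := (#(plaquettesTouching (boxEdges 4 (2 * H + 1))) : ℝ))
    (N := (Fintype.card (ColdFreeIdx H) : ℝ)) hβ1 hy hu huy (Nat.cast_nonneg _) hP (Nat.cast_nonneg _) hN h7 h6 h8 h10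
  rw [rpow_neg_nine_eq hβ0]
  linarith [hcore, hrhs]

/-! ## The registered stub, by name -/

/-- **Stub S3c of crux `ColdBoxTwoPointFloorW` (line `birth`, skeleton v5 `541595052a14e13c`) — Gaussian domination of the connected
plaquette covariance in the cold box, under the exponent ceiling `θ₀ = 1/100`.**  There is `θ₀ > 0` such that for all `0 < A < θ ≤ θ₀`,
eventually in `β`: `|β² · boxPlaqCov(β, ⌈β^θ⌉, ⌈β^A⌉) − ¾ · boxCircSqCov| ≤ ½ · boxMaxwellPlaqCov²`.
Proof: `boxDirichletDominationAbs` (this file) and `stub_boxGaussianDomination_of_abs` (`…ColdBoxStubOfAbs`). -/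
theorem stub_boxGaussianDomination : ∃ θ₀ : ℝ, 0 < θ₀ ∧ ∀ A θ : ℝ, 0 < A → A < θ → θ ≤ θ₀ → ∃ β₀ : ℝ, ∀ β : ℝ, β₀ ≤ β → |β ^ 2 * boxPlaqCov (Literature.MathematicalPhysics.QuantumLattice.fundamentalRep (Fin 2)) β ⌈β ^ θ⌉₊ ⌈β ^ A⌉₊ - 3 / 4 * boxCircSqCov ⌈β ^ θ⌉₊ ⌈β ^ A⌉₊| ≤ 1 / 2 * boxMaxwellPlaqCov ⌈β ^ θ⌉₊ ⌈β ^ A⌉₊ ^ 2 :=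
  stub_boxGaussianDomination_of_abs boxDirichletDominationAbs

end Summit.QuantumFields.YangMills.Theorems.WeakCouplingRates

end
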